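import Summits.Ventures.LatticeQCDFlow.Scoring.PlaquetteWeakCouplingSU
import Summits.Ventures.LatticeQCDFlow.Scoring.SpecialUnitaryWeylWeightedSq
import Summits.Ventures.LatticeQCDFlow.Scoring.SpecialUnitaryGaussFourthMoment
import HarnessLib

/-!
# Equipartition at weak coupling for the `SU(N)` plaquette, every `N`: `β² · Var_β(Re tr U_p) → (N² − 1)/2 = dim SU(N)/2` as `β → ∞`

HONEST FRAMING: exact (Metropolis-corrected) sampling algorithms for lattice gauge theory;
figures of merit are autocorrelation/cost numbers at stated couplings and volumes; no
continuum-physics claim.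

Venture `LatticeQCDFlow` (cell pub-lqcd), sub-topic `Scoring`; FANOUT row 5 (`s0-sun-a`), GEN-20.
NEW WORK of the cell (placement rule).  The `SU(N)` twin of `PlaquetteVarianceWeakCoupling` (`U(N)`: `β² Var → N²/2`):
with Weyl's formula for `(N − Re tr U)² e^{x Re tr U}` on `SU(N)` (`SpecialUnitaryWeylWeightedSq`), the squared-weight Laplace
limit on the `SU(N)` torus and the fourth moment `∫ (Σφ_b(ψ)²)² e^{−Σφ²/2}Δ² = (N²−1)(N²+1) M^{SU}`
(`SpecialUnitaryGaussFourthMoment`):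

* §2 `integral_suSqWeightedScaledIntegrand_eq`, **`tendsto_integral_suSqWeightedScaledIntegrand`** (`→ ((N²−1)(N²+1)/4) M^{SU}`);
* §3 **`tendsto_sq_mul_iteratedDeriv_two_log_tsum_det_besselI`** (`x²(log Σ_q det[I_{|q+i−j|}])″(x) → (N² − 1)/2`) and
  **`tendsto_sq_mul_specialUnitary_plaquette_variance`** (`β² · Var_β(N⁻¹ Re tr U) → (N² − 1)/(2N²)`, every `N ≥ 1`:
  equipartition over the `N² − 1 = dim SU(N)` quadratic modes; `SU(2)`: `3/8`, `SU(3)`: `4/9`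
  (`tendsto_sq_mul_specialUnitary_three_plaquette_variance`)).

No `def`, nothing cited as a fact, 0 sorry.
-/

noncomputable section

open Real MeasureTheory Filter Topology Finset
open scoped ENNReal
open Complex (I)
open Literature.MathematicalPhysics.QuantumFieldTheory (haarProbability)
open Literature.Analysis.FunctionSpaces (besselI)
open Literature.RepresentationTheory.CompactGroups
open Literature.RepresentationTheory.CompactGroups.WeylIntegration
open ProbabilityTheory (mgf cgf hasDerivAt_mgf iteratedDeriv_two_cgf deriv_cgf)

namespace Summit.Ventures.LatticeQCDFlow.Scoring

/-! ### 2. The squared-weight Laplace limit on the `SU(N)` torus -/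

/-- **Change of variables for the squared-weight `SU(N)` integrand** (`x > 0`, `N ≥ 1`). -/
theorem integral_suSqWeightedScaledIntegrand_eq {N : ℕ} [NeZero N] {x : ℝ} (hx : 0 < x) :
    ∫ ψ : {i : Fin N // i ≠ 0} → ℝ, (∑ b : Fin N, x * (1 - Real.cos ((if h : b = (0 : Fin N) then -∑ k, ψ k else ψ ⟨b, h⟩ : ℝ) / √x))) ^ 2 *
        ((fun ψ : {i : Fin N // i ≠ 0} → ℝ => fun k => ψ k / √x) ⁻¹' Set.univ.pi fun _ => Set.Ioc (-π) π).indicator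
          (fun ψ => Real.exp (∑ b : Fin N, x * (Real.cos ((if h : b = (0 : Fin N) then -∑ k, ψ k else ψ ⟨b, h⟩ : ℝ) / √x) - 1)) *
            ∏ p : OD (Fin N), (2 * x * (1 - Real.cos (((if h : p.1.1 = (0 : Fin N) then -∑ k, ψ k else ψ ⟨p.1.1, h⟩ : ℝ) - (if h : p.1.2 = (0 : Fin N) then -∑ k, ψ k else ψ ⟨p.1.2, h⟩ : ℝ)) / √x)))) ψ
      = Real.exp (-(N * x)) * x ^ Fintype.card (OD (Fin N)) * √x ^ Fintype.card {i : Fin N // i ≠ 0} *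
        ∫ θ : {i : Fin N // i ≠ 0} → ℝ,
          (∑ b : Fin N, x * (1 - Real.cos (if h : b = (0 : Fin N) then -∑ k, θ k else θ ⟨b, h⟩ : ℝ))) ^ 2 *
            (Real.exp (x * ∑ b : Fin N, Real.cos (if h : b = (0 : Fin N) then -∑ k, θ k else θ ⟨b, h⟩ : ℝ)) *
              ∏ p : OD (Fin N), ‖Complex.exp ((((if h : p.1.1 = (0 : Fin N) then -∑ k, θ k else θ ⟨p.1.1, h⟩ : ℝ)) : ℂ) * I) - Complex.exp ((((if h : p.1.2 = (0 : Fin N) then -∑ k, θ k else θ ⟨p.1.2, h⟩ : ℝ)) : ℂ) * I)‖ ^ 2)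
          ∂(Measure.pi fun _ : {i : Fin N // i ≠ 0} => (volume : Measure ℝ).restrict (Set.Ioc (-π) π)) := by
  have hsx : 0 < √x := Real.sqrt_pos.2 hx
  set c : ℝ := (√x)⁻¹ with hc
  set F : ({i : Fin N // i ≠ 0} → ℝ) → ℝ := fun θ => (∑ b : Fin N, x * (1 - Real.cos (if h : b = (0 : Fin N) then -∑ k, θ k else θ ⟨b, h⟩ : ℝ))) ^ 2 *
    (Real.exp (x * ∑ b : Fin N, Real.cos (if h : b = (0 : Fin N) then -∑ k, θ k else θ ⟨b, h⟩ : ℝ)) *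
      ∏ p : OD (Fin N), (2 - 2 * Real.cos ((if h : p.1.1 = (0 : Fin N) then -∑ k, θ k else θ ⟨p.1.1, h⟩ : ℝ) - (if h : p.1.2 = (0 : Fin N) then -∑ k, θ k else θ ⟨p.1.2, h⟩ : ℝ)))) with hF
  set cube : Set ({i : Fin N // i ≠ 0} → ℝ) := Set.univ.pi fun _ => Set.Ioc (-π) π with hcube
  have hcube_meas : MeasurableSet cube := MeasurableSet.univ_pi fun _ => measurableSet_Ioc
  have htorus : ∫ θ : {i : Fin N // i ≠ 0} → ℝ,
          (∑ b : Fin N, x * (1 - Real.cos (if h : b = (0 : Fin N) then -∑ k, θ k else θ ⟨b, h⟩ : ℝ))) ^ 2 *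
            (Real.exp (x * ∑ b : Fin N, Real.cos (if h : b = (0 : Fin N) then -∑ k, θ k else θ ⟨b, h⟩ : ℝ)) *
              ∏ p : OD (Fin N), ‖Complex.exp ((((if h : p.1.1 = (0 : Fin N) then -∑ k, θ k else θ ⟨p.1.1, h⟩ : ℝ)) : ℂ) * I) - Complex.exp ((((if h : p.1.2 = (0 : Fin N) then -∑ k, θ k else θ ⟨p.1.2, h⟩ : ℝ)) : ℂ) * I)‖ ^ 2)
          ∂(Measure.pi fun _ : {i : Fin N // i ≠ 0} => (volume : Measure ℝ).restrict (Set.Ioc (-π) π))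
      = ∫ θ : {i : Fin N // i ≠ 0} → ℝ, cube.indicator F θ := by
    simp_rw [norm_cexp_sub_cexp_sq]
    rw [← Measure.restrict_pi_pi, ← volume_pi, integral_indicator hcube_meas]
  have hscale : ∀ ψ : {i : Fin N // i ≠ 0} → ℝ, (fun k => ψ k / √x) = c • ψ := by
    intro ψ; funext k; simp [hc, div_eq_inv_mul]
  have hind : ∀ ψ : {i : Fin N // i ≠ 0} → ℝ, (∑ b : Fin N, x * (1 - Real.cos ((if h : b = (0 : Fin N) then -∑ k, ψ k else ψ ⟨b, h⟩ : ℝ) / √x))) ^ 2 *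
      ((fun ψ : {i : Fin N // i ≠ 0} → ℝ => fun k => ψ k / √x) ⁻¹' cube).indicator
        (fun ψ => Real.exp (∑ b : Fin N, x * (Real.cos ((if h : b = (0 : Fin N) then -∑ k, ψ k else ψ ⟨b, h⟩ : ℝ) / √x) - 1)) *
          ∏ p : OD (Fin N), (2 * x * (1 - Real.cos (((if h : p.1.1 = (0 : Fin N) then -∑ k, ψ k else ψ ⟨p.1.1, h⟩ : ℝ) - (if h : p.1.2 = (0 : Fin N) then -∑ k, ψ k else ψ ⟨p.1.2, h⟩ : ℝ)) / √x)))) ψ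
      = Real.exp (-(N * x)) * x ^ Fintype.card (OD (Fin N)) * (cube.indicator F) (c • ψ) := by
    intro ψ
    by_cases hψ : (fun k => ψ k / √x) ∈ cube
    · rw [Set.indicator_of_mem (show ψ ∈ (fun ψ : {i : Fin N // i ≠ 0} → ℝ => fun k => ψ k / √x) ⁻¹' cube from hψ),
        Set.indicator_of_mem (show c • ψ ∈ cube by rwa [← hscale]),
        scaledIntegrand_eq_mul x (fun b : Fin N => (if h : b = (0 : Fin N) then -∑ k, ψ k else ψ ⟨b, h⟩ : ℝ)), hF, ← hscale]
      simp only [phase_div, Fintype.card_fin]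
      ring
    · rw [Set.indicator_of_notMem (show ψ ∉ (fun ψ : {i : Fin N // i ≠ 0} → ℝ => fun k => ψ k / √x) ⁻¹' cube from hψ),
        Set.indicator_of_notMem (show c • ψ ∉ cube by rwa [← hscale]), mul_zero, mul_zero]
  simp_rw [hind]
  rw [integral_const_mul, Measure.integral_comp_smul volume (cube.indicator F) c, htorus,
    Module.finrank_fintype_fun_eq_card, smul_eq_mul]
  have hcN : |(c ^ Fintype.card {i : Fin N // i ≠ 0})⁻¹| = √x ^ Fintype.card {i : Fin N // i ≠ 0} := by
    rw [hc, inv_pow, inv_inv, abs_of_pos (pow_pos hsx _)]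
  rw [hcN]
  ring

/-- **The squared-weight Laplace limit on the `SU(N)` torus**: `→ ((N² − 1)(N² + 1)/4) · M^{SU}_N`. -/
theorem tendsto_integral_suSqWeightedScaledIntegrand (N : ℕ) [NeZero N] :
    Tendsto (fun x : ℝ => ∫ ψ : {i : Fin N // i ≠ 0} → ℝ, (∑ b : Fin N, x * (1 - Real.cos ((if h : b = (0 : Fin N) then -∑ k, ψ k else ψ ⟨b, h⟩ : ℝ) / √x))) ^ 2 *
        ((fun ψ : {i : Fin N // i ≠ 0} → ℝ => fun k => ψ k / √x) ⁻¹' Set.univ.pi fun _ => Set.Ioc (-π) π).indicator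
          (fun ψ => Real.exp (∑ b : Fin N, x * (Real.cos ((if h : b = (0 : Fin N) then -∑ k, ψ k else ψ ⟨b, h⟩ : ℝ) / √x) - 1)) *
            ∏ p : OD (Fin N), (2 * x * (1 - Real.cos (((if h : p.1.1 = (0 : Fin N) then -∑ k, ψ k else ψ ⟨p.1.1, h⟩ : ℝ) - (if h : p.1.2 = (0 : Fin N) then -∑ k, ψ k else ψ ⟨p.1.2, h⟩ : ℝ)) / √x)))) ψ)
      atTop (𝓝 ((((N : ℝ) ^ 2 - 1) * ((N : ℝ) ^ 2 + 1) / 4) * ∫ ψ : {i : Fin N // i ≠ 0} → ℝ, Real.exp (∑ b : Fin N, -((if h : b = (0 : Fin N) then -∑ k, ψ k else ψ ⟨b, h⟩ : ℝ) ^ 2 / 2)) *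
          ∏ p : OD (Fin N), ((if h : p.1.1 = (0 : Fin N) then -∑ k, ψ k else ψ ⟨p.1.1, h⟩ : ℝ) - (if h : p.1.2 = (0 : Fin N) then -∑ k, ψ k else ψ ⟨p.1.2, h⟩ : ℝ)) ^ 2)) := by
  have hlim : (((N : ℝ) ^ 2 - 1) * ((N : ℝ) ^ 2 + 1) / 4) * (∫ ψ : {i : Fin N // i ≠ 0} → ℝ, Real.exp (∑ b : Fin N, -((if h : b = (0 : Fin N) then -∑ k, ψ k else ψ ⟨b, h⟩ : ℝ) ^ 2 / 2)) *
          ∏ p : OD (Fin N), ((if h : p.1.1 = (0 : Fin N) then -∑ k, ψ k else ψ ⟨p.1.1, h⟩ : ℝ) - (if h : p.1.2 = (0 : Fin N) then -∑ k, ψ k else ψ ⟨p.1.2, h⟩ : ℝ)) ^ 2)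
      = ∫ ψ : {i : Fin N // i ≠ 0} → ℝ, ((∑ b : Fin N, (if h : b = (0 : Fin N) then -∑ k, ψ k else ψ ⟨b, h⟩ : ℝ) ^ 2) / 2) ^ 2 *
          (Real.exp (∑ b : Fin N, -((if h : b = (0 : Fin N) then -∑ k, ψ k else ψ ⟨b, h⟩ : ℝ) ^ 2 / 2)) * ∏ p : OD (Fin N), ((if h : p.1.1 = (0 : Fin N) then -∑ k, ψ k else ψ ⟨p.1.1, h⟩ : ℝ) - (if h : p.1.2 = (0 : Fin N) then -∑ k, ψ k else ψ ⟨p.1.2, h⟩ : ℝ)) ^ 2) := by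
    have h := integral_normSq_sq_suGaussVandermonde (n := Fin N) 0
    simp only [Fintype.card_fin] at h
    have e : (fun ψ : {i : Fin N // i ≠ 0} → ℝ => ((∑ b : Fin N, (if h : b = (0 : Fin N) then -∑ k, ψ k else ψ ⟨b, h⟩ : ℝ) ^ 2) / 2) ^ 2 *
        (Real.exp (∑ b : Fin N, -((if h : b = (0 : Fin N) then -∑ k, ψ k else ψ ⟨b, h⟩ : ℝ) ^ 2 / 2)) * ∏ p : OD (Fin N), ((if h : p.1.1 = (0 : Fin N) then -∑ k, ψ k else ψ ⟨p.1.1, h⟩ : ℝ) - (if h : p.1.2 = (0 : Fin N) then -∑ k, ψ k else ψ ⟨p.1.2, h⟩ : ℝ)) ^ 2))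
        = fun ψ => (1 / 4) * ((∑ b : Fin N, (if h : b = (0 : Fin N) then -∑ k, ψ k else ψ ⟨b, h⟩ : ℝ) ^ 2) ^ 2 *
          (Real.exp (∑ b : Fin N, -((if h : b = (0 : Fin N) then -∑ k, ψ k else ψ ⟨b, h⟩ : ℝ) ^ 2 / 2)) * ∏ p : OD (Fin N), ((if h : p.1.1 = (0 : Fin N) then -∑ k, ψ k else ψ ⟨p.1.1, h⟩ : ℝ) - (if h : p.1.2 = (0 : Fin N) then -∑ k, ψ k else ψ ⟨p.1.2, h⟩ : ℝ)) ^ 2)) := by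
      funext ψ; ring
    rw [e, integral_const_mul, h]
    ring
  rw [hlim]
  refine tendsto_integral_filter_of_dominated_convergence
    (fun ψ => ((1 + Fintype.card {i : Fin N // i ≠ 0}) ^ 2 * (4 * Fintype.card {i : Fin N // i ≠ 0}) ^ Fintype.card (OD (Fin N))) *
      ∏ k, (Real.exp (-(2 / π ^ 2 * ψ k ^ 2)) * (1 + ψ k ^ 2) ^ (Fintype.card (OD (Fin N)) + 2))) ?_ ?_
    (integrable_gaussPolyBound _ _)
    (Eventually.of_forall fun ψ => ((tendsto_suLaplaceWeight ψ).pow 2).mul (tendsto_suScaledIntegrand 0 ψ))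
  · filter_upwards [eventually_gt_atTop (0 : ℝ)] with x hx
    refine (Continuous.aestronglyMeasurable ?_).mul (AEStronglyMeasurable.indicator ?_ ?_)
    · exact (continuous_finsetSum _ fun b _ => continuous_const.mul (continuous_const.sub
        (Real.continuous_cos.comp ((continuous_ext_apply 0 b).div_const _)))).pow 2
    · refine Continuous.aestronglyMeasurable ?_
      refine (Real.continuous_exp.comp (continuous_finsetSum _ fun b _ => ?_)).mul
        (continuous_finsetProd _ fun p _ => ?_)
      · exact continuous_const.mul (((Real.continuous_cos.comp
          ((continuous_ext_apply 0 b).div_const _))).sub continuous_const)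
      · exact continuous_const.mul (continuous_const.sub (Real.continuous_cos.comp
          (((continuous_ext_apply 0 p.1.1).sub (continuous_ext_apply 0 p.1.2)).div_const _)))
    · exact (MeasurableSet.univ_pi fun _ => measurableSet_Ioc).preimage (by fun_prop)
  · filter_upwards [eventually_gt_atTop (0 : ℝ)] with x hx
    refine Eventually.of_forall fun ψ => ?_
    have hw := suLaplaceWeight_mem_Icc hx ψ
    have hw2 : (∑ b : Fin N, x * (1 - Real.cos ((if h : b = (0 : Fin N) then -∑ k, ψ k else ψ ⟨b, h⟩ : ℝ) / √x))) ^ 2 ≤ ((∑ b : Fin N, (if h : b = (0 : Fin N) then -∑ k, ψ k else ψ ⟨b, h⟩ : ℝ) ^ 2) / 2) ^ 2 := pow_le_pow_left₀ hw.1 hw.2 2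
    rw [norm_mul, Real.norm_eq_abs, abs_of_nonneg (sq_nonneg _), Real.norm_eq_abs]
    by_cases hψ : ψ ∈ (fun ψ : {i : Fin N // i ≠ 0} → ℝ => fun k => ψ k / √x) ⁻¹' Set.univ.pi fun _ => Set.Ioc (-π) π
    · rw [Set.indicator_of_mem hψ, abs_of_nonneg (mul_nonneg (Real.exp_nonneg _)
        (Finset.prod_nonneg fun p _ => pairFactor_nonneg hx.le _))]
      have hb := suScaledIntegrand_le_bound 0 hx (ψ := ψ) fun k => hψ k (Set.mem_univ _)
      have hsum : ((∑ b : Fin N, (if h : b = (0 : Fin N) then -∑ k, ψ k else ψ ⟨b, h⟩ : ℝ) ^ 2) / 2) ^ 2 ≤ ((1 + Fintype.card {i : Fin N // i ≠ 0}) * ∏ k, (1 + ψ k ^ 2)) ^ 2 := by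
        have h1 := sq_sum_phase_sq_le 0 ψ
        have h0 : 0 ≤ (∑ b : Fin N, (if h : b = (0 : Fin N) then -∑ k, ψ k else ψ ⟨b, h⟩ : ℝ) ^ 2) ^ 2 := sq_nonneg _
        nlinarith
      calc (∑ b : Fin N, x * (1 - Real.cos ((if h : b = (0 : Fin N) then -∑ k, ψ k else ψ ⟨b, h⟩ : ℝ) / √x))) ^ 2 * (Real.exp (∑ b : Fin N, x * (Real.cos ((if h : b = (0 : Fin N) then -∑ k, ψ k else ψ ⟨b, h⟩ : ℝ) / √x) - 1)) *
            ∏ p : OD (Fin N), (2 * x * (1 - Real.cos (((if h : p.1.1 = (0 : Fin N) then -∑ k, ψ k else ψ ⟨p.1.1, h⟩ : ℝ) - (if h : p.1.2 = (0 : Fin N) then -∑ k, ψ k else ψ ⟨p.1.2, h⟩ : ℝ)) / √x))))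
          ≤ ((1 + Fintype.card {i : Fin N // i ≠ 0}) * ∏ k, (1 + ψ k ^ 2)) ^ 2 *
            ((4 * Fintype.card {i : Fin N // i ≠ 0}) ^ Fintype.card (OD (Fin N)) *
              ∏ k, (Real.exp (-(2 / π ^ 2 * ψ k ^ 2)) * (1 + ψ k ^ 2) ^ Fintype.card (OD (Fin N)))) :=
            mul_le_mul (hw2.trans hsum) hb (mul_nonneg (Real.exp_nonneg _)
              (Finset.prod_nonneg fun p _ => pairFactor_nonneg hx.le _)) (by positivity)
        _ = ((1 + Fintype.card {i : Fin N // i ≠ 0}) ^ 2 * (4 * Fintype.card {i : Fin N // i ≠ 0}) ^ Fintype.card (OD (Fin N))) *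
            ∏ k, (Real.exp (-(2 / π ^ 2 * ψ k ^ 2)) * (1 + ψ k ^ 2) ^ (Fintype.card (OD (Fin N)) + 2)) := by
            rw [mul_pow, show ∀ a b c d : ℝ, (a * b) * (c * d) = (a * c) * (b * d) from fun a b c d => by ring,
              ← Finset.prod_pow, ← Finset.prod_mul_distrib]
            congr 1
            exact Finset.prod_congr rfl fun k _ => by ring
    · rw [Set.indicator_of_notMem hψ, abs_zero, mul_zero]
      exact mul_nonneg (by positivity) (Finset.prod_nonneg fun b _ => by positivity)

/-! ### 3. Equipartition: the one-loop law of the `SU(N)` plaquette variance -/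

/-- **`x² · (log Σ_q det[I_{|q+i−j|}])″(x) → (N² − 1)/2`** as `x → ∞`, every `N ≥ 1`: the tilted variance of `Re tr U`
under the `SU(N)` one-plaquette law at coupling `x` is `(N² − 1)/(2x²)·(1 + o(1))`. -/
theorem tendsto_sq_mul_iteratedDeriv_two_log_tsum_det_besselI (N : ℕ) [NeZero N] :
    Tendsto (fun x : ℝ => x ^ 2 * iteratedDeriv 2 (fun y : ℝ =>
        Real.log (∑' q : ℤ, (Matrix.of fun i j : Fin N => besselI (q + (i : ℤ) - (j : ℤ)).natAbs y).det)) x)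
      atTop (𝓝 (((N : ℝ) ^ 2 - 1) / 2)) := by
  set M : ℝ := ∫ ψ : {i : Fin N // i ≠ 0} → ℝ, Real.exp (∑ b : Fin N, -((if h : b = (0 : Fin N) then -∑ k, ψ k else ψ ⟨b, h⟩ : ℝ) ^ 2 / 2)) *
          ∏ p : OD (Fin N), ((if h : p.1.1 = (0 : Fin N) then -∑ k, ψ k else ψ ⟨p.1.1, h⟩ : ℝ) - (if h : p.1.2 = (0 : Fin N) then -∑ k, ψ k else ψ ⟨p.1.2, h⟩ : ℝ)) ^ 2 with hM
  have hMpos : 0 < M := suGaussVandermonde_pos (n := Fin N) 0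
  have hK : (0 : ℝ) < (2 * π) ^ (N - 1) * N.factorial := by positivity
  have hden := tendsto_tsum_det_besselI_weakCoupling N
  have hnum : Tendsto (fun x : ℝ => x ^ 2 * (∫ u, ((((N : ℝ) - ((u : Matrix.specialUnitaryGroup (Fin N) ℂ) : Matrix (Fin N) (Fin N) ℂ).trace.re) ^ 2) *
        Real.exp (x * ((u : Matrix.specialUnitaryGroup (Fin N) ℂ) : Matrix (Fin N) (Fin N) ℂ).trace.re)) ∂(haarProbability (Matrix.specialUnitaryGroup (Fin N) ℂ))) *
      Real.exp (-(N * x)) * √x ^ (N ^ 2 - 1)) atTop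
      (𝓝 ((((N : ℝ) ^ 2 - 1) * ((N : ℝ) ^ 2 + 1) / 4) * M / ((2 * π) ^ (N - 1) * N.factorial))) := by
    have h := (tendsto_integral_suSqWeightedScaledIntegrand N).div_const ((2 * π) ^ (N - 1) * N.factorial)
    refine h.congr' ?_
    filter_upwards [eventually_gt_atTop (0 : ℝ)] with x hx
    have hpow : √x ^ (N ^ 2 - 1) = x ^ Fintype.card (OD (Fin N)) * √x ^ Fintype.card {i : Fin N // i ≠ 0} := by
      have hc := card_ne_add_two_mul_card_OD (n := Fin N) 0
      simp only [Fintype.card_fin] at hc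
      rw [← hc, pow_add, pow_mul, Real.sq_sqrt hx.le, mul_comm]
    have hI : (∫ θ : {i : Fin N // i ≠ 0} → ℝ,
          (∑ b : Fin N, x * (1 - Real.cos (if h : b = (0 : Fin N) then -∑ k, θ k else θ ⟨b, h⟩ : ℝ))) ^ 2 *
            (Real.exp (x * ∑ b : Fin N, Real.cos (if h : b = (0 : Fin N) then -∑ k, θ k else θ ⟨b, h⟩ : ℝ)) *
              ∏ p : OD (Fin N), ‖Complex.exp ((((if h : p.1.1 = (0 : Fin N) then -∑ k, θ k else θ ⟨p.1.1, h⟩ : ℝ)) : ℂ) * I) - Complex.exp ((((if h : p.1.2 = (0 : Fin N) then -∑ k, θ k else θ ⟨p.1.2, h⟩ : ℝ)) : ℂ) * I)‖ ^ 2)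
          ∂(Measure.pi fun _ : {i : Fin N // i ≠ 0} => (volume : Measure ℝ).restrict (Set.Ioc (-π) π)))
        = x ^ 2 * ∫ θ : {i : Fin N // i ≠ 0} → ℝ,
          (∑ b : Fin N, (1 - Real.cos (if h : b = (0 : Fin N) then -∑ k, θ k else θ ⟨b, h⟩ : ℝ))) ^ 2 *
            (Real.exp (x * ∑ b : Fin N, Real.cos (if h : b = (0 : Fin N) then -∑ k, θ k else θ ⟨b, h⟩ : ℝ)) *
              ∏ p : OD (Fin N), ‖Complex.exp ((((if h : p.1.1 = (0 : Fin N) then -∑ k, θ k else θ ⟨p.1.1, h⟩ : ℝ)) : ℂ) * I) - Complex.exp ((((if h : p.1.2 = (0 : Fin N) then -∑ k, θ k else θ ⟨p.1.2, h⟩ : ℝ)) : ℂ) * I)‖ ^ 2)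
          ∂(Measure.pi fun _ : {i : Fin N // i ≠ 0} => (volume : Measure ℝ).restrict (Set.Ioc (-π) π)) := by
      rw [← integral_const_mul]
      refine integral_congr_ae (Eventually.of_forall fun θ => ?_)
      dsimp only
      generalize (Real.exp (x * ∑ b : Fin N, Real.cos (if h : b = (0 : Fin N) then -∑ k, θ k else θ ⟨b, h⟩ : ℝ)) *
              ∏ p : OD (Fin N), ‖Complex.exp ((((if h : p.1.1 = (0 : Fin N) then -∑ k, θ k else θ ⟨p.1.1, h⟩ : ℝ)) : ℂ) * I) - Complex.exp ((((if h : p.1.2 = (0 : Fin N) then -∑ k, θ k else θ ⟨p.1.2, h⟩ : ℝ)) : ℂ) * I)‖ ^ 2) = R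
      rw [← Finset.mul_sum]
      ring
    rw [integral_suSqWeightedScaledIntegrand_eq (N := N) hx, hI, integral_haar_specialUnitaryGroup_sub_trace_sq_mul_exp, hpow]
    set J : ℝ := ∫ θ : {i : Fin N // i ≠ 0} → ℝ,
          (∑ b : Fin N, (1 - Real.cos (if h : b = (0 : Fin N) then -∑ k, θ k else θ ⟨b, h⟩ : ℝ))) ^ 2 *
            (Real.exp (x * ∑ b : Fin N, Real.cos (if h : b = (0 : Fin N) then -∑ k, θ k else θ ⟨b, h⟩ : ℝ)) *
              ∏ p : OD (Fin N), ‖Complex.exp ((((if h : p.1.1 = (0 : Fin N) then -∑ k, θ k else θ ⟨p.1.1, h⟩ : ℝ)) : ℂ) * I) - Complex.exp ((((if h : p.1.2 = (0 : Fin N) then -∑ k, θ k else θ ⟨p.1.2, h⟩ : ℝ)) : ℂ) * I)‖ ^ 2)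
          ∂(Measure.pi fun _ : {i : Fin N // i ≠ 0} => (volume : Measure ℝ).restrict (Set.Ioc (-π) π)) with hJ
    field_simp
  have hne : M / ((2 * π) ^ (N - 1) * N.factorial) ≠ 0 := (div_pos hMpos hK).ne'
  have hq := hnum.div hden hne
  have hval : (((N : ℝ) ^ 2 - 1) * ((N : ℝ) ^ 2 + 1) / 4) * M / ((2 * π) ^ (N - 1) * N.factorial) /
      (M / ((2 * π) ^ (N - 1) * N.factorial)) = ((N : ℝ) ^ 2 - 1) * ((N : ℝ) ^ 2 + 1) / 4 := by
    field_simp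
  rw [hval] at hq
  have hB := tendsto_mul_sub_deriv_log_tsum_det_besselI N
  have hlim := hq.sub (hB.mul hB)
  have hval2 : ((N : ℝ) ^ 2 - 1) * ((N : ℝ) ^ 2 + 1) / 4 - ((N : ℝ) ^ 2 - 1) / 2 * (((N : ℝ) ^ 2 - 1) / 2)
      = ((N : ℝ) ^ 2 - 1) / 2 := by ring
  rw [hval2] at hlim
  refine hlim.congr' ?_
  filter_upwards [eventually_gt_atTop (0 : ℝ)] with x hx
  simp only [Pi.div_apply]
  have hint := mem_interior_integrableExpSet_of_abs_le_const
    (aestronglyMeasurable_trace_re_specialUnitaryGroup N) (fun u => abs_trace_re_le_card_su u) x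
  have hcgf : (fun y : ℝ =>
        Real.log (∑' q : ℤ, (Matrix.of fun i j : Fin N => besselI (q + (i : ℤ) - (j : ℤ)).natAbs y).det))
      = cgf (fun u : Matrix.specialUnitaryGroup (Fin N) ℂ => ((u : Matrix.specialUnitaryGroup (Fin N) ℂ) : Matrix (Fin N) (Fin N) ℂ).trace.re) (haarProbability (Matrix.specialUnitaryGroup (Fin N) ℂ)) :=
    funext fun y => by rw [cgf, mgf_trace_re_specialUnitaryGroup]
  rw [hcgf, iteratedDeriv_two_cgf hint, deriv_cgf hint, mgf_trace_re_specialUnitaryGroup]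
  have hD := tsum_det_besselI_fin_pos N x
  have hbd : ∀ u : Matrix.specialUnitaryGroup (Fin N) ℂ, |((u : Matrix.specialUnitaryGroup (Fin N) ℂ) : Matrix (Fin N) (Fin N) ℂ).trace.re| ≤ N := fun u => by
    have h := abs_trace_re_le_card_su u
    rwa [Fintype.card_fin] at h
  have hexp_le : ∀ u : Matrix.specialUnitaryGroup (Fin N) ℂ, Real.exp (x * ((u : Matrix.specialUnitaryGroup (Fin N) ℂ) : Matrix (Fin N) (Fin N) ℂ).trace.re) ≤ Real.exp (|x| * N) := by
    intro u
    refine Real.exp_le_exp.2 ?_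
    calc x * ((u : Matrix.specialUnitaryGroup (Fin N) ℂ) : Matrix (Fin N) (Fin N) ℂ).trace.re ≤ |x * ((u : Matrix.specialUnitaryGroup (Fin N) ℂ) : Matrix (Fin N) (Fin N) ℂ).trace.re| := le_abs_self _
      _ = |x| * |((u : Matrix.specialUnitaryGroup (Fin N) ℂ) : Matrix (Fin N) (Fin N) ℂ).trace.re| := abs_mul _ _
      _ ≤ |x| * N := mul_le_mul_of_nonneg_left (hbd u) (abs_nonneg _)
  have hctr : Continuous fun u : Matrix.specialUnitaryGroup (Fin N) ℂ => ((u : Matrix.specialUnitaryGroup (Fin N) ℂ) : Matrix (Fin N) (Fin N) ℂ).trace.re :=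
    Complex.continuous_re.comp (continuous_id.matrix_trace.comp continuous_subtype_val)
  have hce : Continuous fun u : Matrix.specialUnitaryGroup (Fin N) ℂ => Real.exp (x * ((u : Matrix.specialUnitaryGroup (Fin N) ℂ) : Matrix (Fin N) (Fin N) ℂ).trace.re) :=
    Real.continuous_exp.comp (continuous_const.mul hctr)
  have hint0 : Integrable (fun u : Matrix.specialUnitaryGroup (Fin N) ℂ => (N : ℝ) ^ 2 * Real.exp (x * ((u : Matrix.specialUnitaryGroup (Fin N) ℂ) : Matrix (Fin N) (Fin N) ℂ).trace.re))
      (haarProbability (Matrix.specialUnitaryGroup (Fin N) ℂ)) := by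
    refine Integrable.mono' (integrable_const (((N : ℝ) ^ 2) * Real.exp (|x| * N))) (continuous_const.mul hce).aestronglyMeasurable
      (Eventually.of_forall fun u => ?_)
    rw [Real.norm_eq_abs, abs_of_nonneg (by positivity)]
    exact mul_le_mul_of_nonneg_left (hexp_le u) (by positivity)
  have hint1 : Integrable (fun u : Matrix.specialUnitaryGroup (Fin N) ℂ => 2 * (N : ℝ) * (((u : Matrix.specialUnitaryGroup (Fin N) ℂ) : Matrix (Fin N) (Fin N) ℂ).trace.re * Real.exp (x * ((u : Matrix.specialUnitaryGroup (Fin N) ℂ) : Matrix (Fin N) (Fin N) ℂ).trace.re)))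
      (haarProbability (Matrix.specialUnitaryGroup (Fin N) ℂ)) := by
    refine Integrable.mono' (integrable_const (2 * (N : ℝ) * ((N : ℝ) * Real.exp (|x| * N))))
      (continuous_const.mul (hctr.mul hce)).aestronglyMeasurable (Eventually.of_forall fun u => ?_)
    rw [Real.norm_eq_abs, abs_mul, abs_of_nonneg (by positivity : (0 : ℝ) ≤ 2 * N), abs_mul, abs_of_nonneg (Real.exp_nonneg _)]
    exact mul_le_mul_of_nonneg_left (mul_le_mul (hbd u) (hexp_le u) (Real.exp_nonneg _) (Nat.cast_nonneg N))
      (by positivity)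
  have hint2 : Integrable (fun u : Matrix.specialUnitaryGroup (Fin N) ℂ => ((u : Matrix.specialUnitaryGroup (Fin N) ℂ) : Matrix (Fin N) (Fin N) ℂ).trace.re ^ 2 * Real.exp (x * ((u : Matrix.specialUnitaryGroup (Fin N) ℂ) : Matrix (Fin N) (Fin N) ℂ).trace.re))
      (haarProbability (Matrix.specialUnitaryGroup (Fin N) ℂ)) := by
    refine Integrable.mono' (integrable_const (((N : ℝ) ^ 2) * Real.exp (|x| * N))) ((hctr.pow 2).mul hce).aestronglyMeasurable
      (Eventually.of_forall fun u => ?_)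
    rw [Real.norm_eq_abs, abs_mul, abs_of_nonneg (sq_nonneg _), abs_of_nonneg (Real.exp_nonneg _)]
    refine mul_le_mul ?_ (hexp_le u) (Real.exp_nonneg _) (by positivity)
    rw [← sq_abs]
    exact pow_le_pow_left₀ (abs_nonneg _) (hbd u) 2
  have hint01 : Integrable (fun u : Matrix.specialUnitaryGroup (Fin N) ℂ => (N : ℝ) ^ 2 * Real.exp (x * ((u : Matrix.specialUnitaryGroup (Fin N) ℂ) : Matrix (Fin N) (Fin N) ℂ).trace.re) -
      2 * (N : ℝ) * (((u : Matrix.specialUnitaryGroup (Fin N) ℂ) : Matrix (Fin N) (Fin N) ℂ).trace.re * Real.exp (x * ((u : Matrix.specialUnitaryGroup (Fin N) ℂ) : Matrix (Fin N) (Fin N) ℂ).trace.re))) (haarProbability (Matrix.specialUnitaryGroup (Fin N) ℂ)) := hint0.sub hint1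
  have hsplit : ∫ u, ((((N : ℝ) - ((u : Matrix.specialUnitaryGroup (Fin N) ℂ) : Matrix (Fin N) (Fin N) ℂ).trace.re) ^ 2) * Real.exp (x * ((u : Matrix.specialUnitaryGroup (Fin N) ℂ) : Matrix (Fin N) (Fin N) ℂ).trace.re)) ∂(haarProbability (Matrix.specialUnitaryGroup (Fin N) ℂ))
      = (N : ℝ) ^ 2 * (∑' q : ℤ, (Matrix.of fun i j : Fin N => besselI (q + (i : ℤ) - (j : ℤ)).natAbs x).det)
        - 2 * (N : ℝ) * ∫ u, (((u : Matrix.specialUnitaryGroup (Fin N) ℂ) : Matrix (Fin N) (Fin N) ℂ).trace.re * Real.exp (x * ((u : Matrix.specialUnitaryGroup (Fin N) ℂ) : Matrix (Fin N) (Fin N) ℂ).trace.re)) ∂(haarProbability (Matrix.specialUnitaryGroup (Fin N) ℂ))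
        + ∫ u, (((u : Matrix.specialUnitaryGroup (Fin N) ℂ) : Matrix (Fin N) (Fin N) ℂ).trace.re ^ 2 * Real.exp (x * ((u : Matrix.specialUnitaryGroup (Fin N) ℂ) : Matrix (Fin N) (Fin N) ℂ).trace.re)) ∂(haarProbability (Matrix.specialUnitaryGroup (Fin N) ℂ)) := by
    have h1 : ∫ u, ((((N : ℝ) - ((u : Matrix.specialUnitaryGroup (Fin N) ℂ) : Matrix (Fin N) (Fin N) ℂ).trace.re) ^ 2) * Real.exp (x * ((u : Matrix.specialUnitaryGroup (Fin N) ℂ) : Matrix (Fin N) (Fin N) ℂ).trace.re)) ∂(haarProbability (Matrix.specialUnitaryGroup (Fin N) ℂ))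
        = ∫ u, (((N : ℝ) ^ 2 * Real.exp (x * ((u : Matrix.specialUnitaryGroup (Fin N) ℂ) : Matrix (Fin N) (Fin N) ℂ).trace.re) - 2 * (N : ℝ) * (((u : Matrix.specialUnitaryGroup (Fin N) ℂ) : Matrix (Fin N) (Fin N) ℂ).trace.re * Real.exp (x * ((u : Matrix.specialUnitaryGroup (Fin N) ℂ) : Matrix (Fin N) (Fin N) ℂ).trace.re))) +
            ((u : Matrix.specialUnitaryGroup (Fin N) ℂ) : Matrix (Fin N) (Fin N) ℂ).trace.re ^ 2 * Real.exp (x * ((u : Matrix.specialUnitaryGroup (Fin N) ℂ) : Matrix (Fin N) (Fin N) ℂ).trace.re)) ∂(haarProbability (Matrix.specialUnitaryGroup (Fin N) ℂ)) :=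
      integral_congr_ae (Eventually.of_forall fun u => by ring)
    rw [h1, integral_add hint01 hint2, integral_sub hint0 hint1, integral_const_mul, integral_const_mul,
      integral_haar_specialUnitaryGroup_fin_exp_mul_trace_re]
  rw [hsplit]
  have hE : Real.exp (-(N * x)) * √x ^ (N ^ 2 - 1) ≠ 0 := by positivity
  field_simp
  ring

/-- **EQUIPARTITION FOR THE `SU(N)` PLAQUETTE, EVERY `N ≥ 1`**: with `P = N⁻¹ Re tr U` under the one-plaquette (and, in two
dimensions, infinite-volume) `SU(N)` law `∝ e^{−β(N − Re tr U)} dU` at coupling `β`,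
`β² · Var_β(P) → (N² − 1)/(2N²)` as `β → ∞` (i.e. `β² Var_β(Re tr U_p) → (N² − 1)/2 = dim SU(N)/2`). -/
theorem tendsto_sq_mul_specialUnitary_plaquette_variance (N : ℕ) [NeZero N] :
    Tendsto (fun β : ℝ => β ^ 2 * (
      (∫ u, (((u : Matrix.specialUnitaryGroup (Fin N) ℂ) : Matrix (Fin N) (Fin N) ℂ).trace.re / N) ^ 2 *
          Real.exp (-(β * ((N : ℝ) - ((u : Matrix.specialUnitaryGroup (Fin N) ℂ) : Matrix (Fin N) (Fin N) ℂ).trace.re)))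
        ∂(haarProbability (Matrix.specialUnitaryGroup (Fin N) ℂ)))
      / (∫ u, Real.exp (-(β * ((N : ℝ) - ((u : Matrix.specialUnitaryGroup (Fin N) ℂ) : Matrix (Fin N) (Fin N) ℂ).trace.re))) ∂(haarProbability (Matrix.specialUnitaryGroup (Fin N) ℂ)))
      - ((∫ u, ((u : Matrix.specialUnitaryGroup (Fin N) ℂ) : Matrix (Fin N) (Fin N) ℂ).trace.re / N *
          Real.exp (-(β * ((N : ℝ) - ((u : Matrix.specialUnitaryGroup (Fin N) ℂ) : Matrix (Fin N) (Fin N) ℂ).trace.re)))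
        ∂(haarProbability (Matrix.specialUnitaryGroup (Fin N) ℂ)))
      / (∫ u, Real.exp (-(β * ((N : ℝ) - ((u : Matrix.specialUnitaryGroup (Fin N) ℂ) : Matrix (Fin N) (Fin N) ℂ).trace.re))) ∂(haarProbability (Matrix.specialUnitaryGroup (Fin N) ℂ)))) ^ 2)) atTop (𝓝 (((N : ℝ) ^ 2 - 1) / (2 * (N : ℝ) ^ 2))) := by
  simp_rw [specialUnitary_plaquette_variance_eq]
  have hN : (N : ℝ) ≠ 0 := Nat.cast_ne_zero.2 (NeZero.ne N)
  have h := (tendsto_sq_mul_iteratedDeriv_two_log_tsum_det_besselI N).const_mul (1 / (N : ℝ) ^ 2)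
  rw [show 1 / (N : ℝ) ^ 2 * (((N : ℝ) ^ 2 - 1) / 2) = ((N : ℝ) ^ 2 - 1) / (2 * (N : ℝ) ^ 2) by field_simp] at h
  refine h.congr fun β => ?_
  ring

/-- **`SU(3)`**: `β² · Var_β(P) → 4/9`. -/
theorem tendsto_sq_mul_specialUnitary_three_plaquette_variance :
    Tendsto (fun β : ℝ => β ^ 2 * (
      (∫ u, (((u : Matrix.specialUnitaryGroup (Fin 3) ℂ) : Matrix (Fin 3) (Fin 3) ℂ).trace.re / (3 : ℕ)) ^ 2 *
          Real.exp (-(β * (((3 : ℕ) : ℝ) - ((u : Matrix.specialUnitaryGroup (Fin 3) ℂ) : Matrix (Fin 3) (Fin 3) ℂ).trace.re)))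
        ∂(haarProbability (Matrix.specialUnitaryGroup (Fin 3) ℂ)))
      / (∫ u, Real.exp (-(β * (((3 : ℕ) : ℝ) - ((u : Matrix.specialUnitaryGroup (Fin 3) ℂ) : Matrix (Fin 3) (Fin 3) ℂ).trace.re)))
        ∂(haarProbability (Matrix.specialUnitaryGroup (Fin 3) ℂ)))
      - ((∫ u, ((u : Matrix.specialUnitaryGroup (Fin 3) ℂ) : Matrix (Fin 3) (Fin 3) ℂ).trace.re / (3 : ℕ) *
          Real.exp (-(β * (((3 : ℕ) : ℝ) - ((u : Matrix.specialUnitaryGroup (Fin 3) ℂ) : Matrix (Fin 3) (Fin 3) ℂ).trace.re)))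
        ∂(haarProbability (Matrix.specialUnitaryGroup (Fin 3) ℂ)))
      / (∫ u, Real.exp (-(β * (((3 : ℕ) : ℝ) - ((u : Matrix.specialUnitaryGroup (Fin 3) ℂ) : Matrix (Fin 3) (Fin 3) ℂ).trace.re)))
        ∂(haarProbability (Matrix.specialUnitaryGroup (Fin 3) ℂ)))) ^ 2)) atTop (𝓝 (4 / 9)) := by
  have h := tendsto_sq_mul_specialUnitary_plaquette_variance 3
  norm_num at h ⊢
  exact h

end Summit.Ventures.LatticeQCDFlow.Scoring
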